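import Summits.BirchSwinnertonDyer.Rank1Residual.X11a.PrintDischarge
import Summits.BirchSwinnertonDyer.Rank1Residual.X11a.CMPartner
import Summits.BirchSwinnertonDyer.Rank1Residual.X11b.ClassClosureCongruenceTransport
import HarnessLib

/-!
# Class X11a — the PRINT route's discharge interface, part 3: the μ-TRANSPORT road BY NAME on the
# surjective leaf (Burungale–Castella–Skinner 2025 Thm. 1.1.2 (b) for a good-ordinary congruent
# partner + Emerton–Pollack–Weston 2006 Cor. 5.1.4), pair side = partner + ONE unit coefficient
# (cell `bsd-print-x11a`, seat ty2; D-0131 (2))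

PARTITION CURRENCY (D-0054 (2) / D-0131 (2)): leaf `ClassX11a W p` (`r_an = 0`, `p` odd, `p ‖ N`,
`E[p]` irreducible, no (ram) prime). THEOREMS ONLY: no definition, no named fact, nothing asserted;
every published input is an explicit named-fact hypothesis already in the tree. Part 1
(`X11a/PrintDischarge.lean`: atoms, walls, image, bundles, glue, visibility closing form) and part 2
(`X11a/PrintDischargeFouquet.lean`: the Fouquet 2025 + BCS-seed road — referee ruling R0-9: that door
is PRE-flagged on every X11a row) are imported / not restated.

WHAT THIS FILE IS. The route's crux `X11aLowerHalf` (item stmt-BirchSwinnertonDyer-19064; on the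
surjective leaf ⟺ `BSD(E,p)` ⟺ Mazur's main conjecture at the pair) has ONE flag-free printed road
PER PAIR that needs neither (ram) nor `μ = 0` for `E` itself — the planner's «μ-transport line»
(PLAN.md v1 §2, p2): take a curve `E₁/ℚ` with GOOD ORDINARY reduction at `p` and `E₁[p] ≃ E[p]`
(`Γ_ℚ`-equivariantly); Burungale–Castella–Skinner, IMRN 2025, Thm. 1.1.2 (b) (tree fact
`BurungaleCastellaSkinner2025.thm112b_charIdeal_eq_padicLFunction_integral`, PUBLISHED; hypotheses
`p > 3`, good ordinary, (irr_ℚ), (im) — NO (ram), NO (mult)) gives the INTEGRAL cyclotomic main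
conjecture for `E₁`; ONE unit coefficient of `ϖ₁ · L_p(f_{E₁}, α)` ("`μ^an(E₁) = 0`", a finite
certificate) makes it the Emerton–Pollack–Weston source shape `GoodOrdinaryCharIdealMuZero E₁ p`
(tree theorem `X11b.ClassClosure.goodOrdinaryCharIdealMuZero_of_thm112b`); Emerton–Pollack–Weston,
Invent. Math. 163 (2006), Cor. 5.1.4 + Thm. 5.1.3 in the instance (weight 2, good ordinary) →
(weight 2, `p ‖ N`) (tree fact `EmertonPollackWeston2006.cor514_transfer_of_goodOrdinary`, PUBLISHED
— this IS "EPW Thm. 1 at the multiplicative point" in curve-partner shape) moves it along the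
congruence to `MultiplicativeCharIdealMuZero E p`, i.e. Mazur's main conjecture at `(E,p)` integrally
WITH `μ = 0`; the tree's height-free rank-`0` glue (Stein–Wuthrich 2013 Thm. 6.1 split/non-split,
Greenberg–Stevens, GZK, modularity) then gives `BSDp W p`, hence the crux's body
`Typed.MissingLowerBoundAt W p` at the pair. The CM-partner road of `X11a/CMPartner.lean` is the
special case "`E₁ = A` CM, Rubin 1991 instead of BCS"; the X11b (rank one) twin is
`X11b.ClassClosure.bsdp_of_goodOrdinaryPartner_of_surj_of_regulatorNonvanishing`.

DISCHARGE ON THE LEAF. Of BCS's hypotheses on the PARTNER, three follow from the CLASS of `E` plus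
the congruence and the mod-`p` image bit of `E`: `p > 3` (⟸ `p ≠ 3` on X11a), (irr_ℚ) for `E₁`
(⟸ `Irr W p`), (im) for `E₁` (⟸ `Surj W p` transported, then Serre: `X9.bigIm_of_surj`, `p ≥ 5`);
of EPW's, `5 ≤ p`, `E` multiplicative at `p`, `E₁[p]` irreducible likewise. What stays PER PAIR
(certificate-record fields, ty3 schema `partners`/`mu`): the partner `E₁` (globally minimal model,
good ordinary at `p`), the `Γ_ℚ`-isomorphism `E₁[p] ≃ E[p]` (Kraus–Oesterlé / Sturm trace
comparison), ONE unit coefficient of `ϖ₁ · L_p(f_{E₁}, α)`, and the image bit `Surj W p` (a theorem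
off the locus `p ∈ {5,7} ∧ p ∣ v_p(Δ_min) ∧ ¬semistable`, part 1 `not_surj_shape`).

| binder of the cited fact | discharged by | lemma |
|---|---|---|
| BCS (b) `3 < p` | `ClassX11a`, `p ≠ 3` | `ClassX11a.three_lt_of_ne_three` (part 1) |
| BCS (b) `Irr W₁ p` | `Irr W p` + congruence | `bcsPartner_hypotheses` |
| BCS (b) `BigIm W₁ p` | `Surj W p` + congruence + `5 ≤ p` | `bcsPartner_hypotheses` |
| BCS (b) `GoodOrd W₁ p` | PER PAIR (partner datum) | binders `hgood₁`, `hord₁` |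
| EPW `5 ≤ p`, `Mult W p`, `W₁[p] ≃ W[p]`, `Irr W₁ p` | class + congruence | `multCharIdealMuZero_of_bcsPartner` |
| "`μ^an(E₁) = 0`" (one unit coefficient) | PER PAIR (certificate) | binder `hcert₁` |

BOUNDARY (theorems below): on the NON-surjective sub-leaf the road is VOID — every congruent partner
`E₁` of a non-surjective X11a pair violates (im) (`not_bigIm_partner_of_not_surj`); and a partner
good at `p` exists only if `E[p]` is finite (peu ramifié) at `p`, i.e. on the locus
`p ∣ v_p(Δ_min)` (Serre 1987 §2.9 Prop. 5; tree `not_good_of_isTresRamifie_of_addEquiv_decomp`;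
seat p2's kit evidence j280133: the four engine-less leaf pairs are très ramifié). So the road serves
the surjective, peu-ramifié X11a pairs at `p ≥ 5` — per pair (E1 currency), never the class.

References: [BurungaleCastellaSkinner2025] Thm. 1.1.2 (b) (§1.1, p. 2 of arXiv:2405.00270v2);
[EmertonPollackWeston2006] Cor. 5.1.4, Thm. 5.1.3 (arXiv:math/0404484 p. 30); [SteinWuthrich2013]
Thm. 6.1; [Serre1972] §2.4 Prop. 15; [SerreAbelianLadic1968] IV §3.4; [Miller2011LMS] Def. 1.1;
cell files `pub/bsd-print-x11a/PLAN.md` §2, `TY2-DISCHARGE-INTERFACE.md`.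
-/

set_option autoImplicit false

noncomputable section

open scoped Classical MatrixGroups ModularForm

open CongruenceSubgroup WeierstrassCurve Literature.NumberTheory.EllipticCurves
  Literature.NumberTheory.EllipticCurves.ModularForms
  Literature.NumberTheory.EllipticCurves.Rank1Residual
  Literature.NumberTheory.EllipticCurves.Rank1Residual.Typed
  Literature.NumberTheory.EllipticCurves.Wuthrich2014
  Literature.NumberTheory.EllipticCurves.SteinWuthrich2013
  Literature.NumberTheory.EllipticCurves.EmertonPollackWeston2006
  Literature.NumberTheory.EllipticCurves.BurungaleCastellaSkinner2025
  Summit.BirchSwinnertonDyer.Rank1Residual.GaloisImage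

namespace Summit.BirchSwinnertonDyer.Rank1Residual.X11a

/-! ### §1 The partner-side hypotheses of BCS 2025 Thm. 1.1.2 (b) that the CLASS of `E` discharges -/

section PartnerHypotheses

variable {W : WeierstrassCurve ℚ} [W.IsElliptic] [W.IsGloballyMinimal] {p : ℕ} [Fact p.Prime]
  {W₁ : WeierstrassCurve ℚ} [W₁.IsElliptic] [W₁.IsGloballyMinimal]

omit [W.IsElliptic] [W₁.IsGloballyMinimal] in
/-- **BCS 2025 Thm. 1.1.2 (b) for the PARTNER — the binders `3 < p`, (irr_ℚ), (im)**, from the class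
of `E`, `p ≠ 3`, the mod-`p` image bit of `E` and a `Γ_ℚ`-equivariant `E₁[p] ≃ E[p]`: irreducibility
and surjectivity are transported along the congruence (tree `hasIrreducibleModPGaloisRep_of_torsionIso_symm`,
`GaloisImage.hasSurjectiveModNGaloisRep_of_torsionIso`), and at `p ≥ 5` surjectivity gives (im)
(Serre IV §3.4 + the transvection `(1 1; 0 1)`: tree `X9.bigIm_of_surj`). The remaining binder
`GoodOrd W₁ p` is the partner datum itself. [cite: BurungaleCastellaSkinner2025, Thm. 1.1.2 (b) (§1.1, p. 2), hypotheses (irr_Q), (im)]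
[cite: SerreAbelianLadic1968, Ch. IV §3.4 Lemma 3] -/
theorem _root_.Summit.BirchSwinnertonDyer.Rank1Residual.ClassX11a.bcsPartner_hypotheses
    (hX : ClassX11a W p) (h3 : p ≠ 3) (hsurj : Surj W p)
    (e : geomTorsion W₁ (p : ℤ) ≃+ geomTorsion W (p : ℤ))
    (he : ∀ (σ : Field.absoluteGaloisGroup ℚ) (P : geomTorsion W₁ (p : ℤ)), e (σ • P) = σ • e P) :
    3 < p ∧ Irr W₁ p ∧ Surj W₁ p ∧ BigIm W₁ p := by
  have h5 : 5 ≤ p := hX.five_le_of_ne_three h3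
  have hirr₁ : Irr W₁ p := hasIrreducibleModPGaloisRep_of_torsionIso_symm e he hX.irr
  have hsurj₁ : Surj W₁ p :=
    hasSurjectiveModNGaloisRep_of_torsionIso e.symm (torsionIso_symm_smul e he) hsurj
  exact ⟨by omega, hirr₁, hsurj₁, X9.bigIm_of_surj W₁ p h5 hsurj₁⟩

omit [W.IsElliptic] [W₁.IsGloballyMinimal] in
/-- **Boundary: on the NON-surjective sub-leaf no partner has (im).** If `ρ̄_{E,p}` is not onto,
every curve `E₁` with `E₁[p] ≃ E[p]` (`Γ_ℚ`-equivariantly) has `E₁[p]` irreducible and NOT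
surjective, hence violates BCS's (im) (tree `not_bigIm_of_irr_of_not_surj`): the μ-transport road
through BCS 2025 Thm. 1.1.2 (b) is confined to the surjective leaf (crux `X11aNonSurjEulerHalf`'s
domain is untouched by it). [cite: BurungaleCastellaSkinner2025, p. 2, hypothesis (im) and Rem. 1.1.3 (iii)]
[cite: Serre1972, §2.4 Prop. 15] -/
theorem _root_.Summit.BirchSwinnertonDyer.Rank1Residual.ClassX11a.not_bigIm_partner_of_not_surj
    (hX : ClassX11a W p) (hns : ¬ Surj W p)
    (e : geomTorsion W₁ (p : ℤ) ≃+ geomTorsion W (p : ℤ))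
    (he : ∀ (σ : Field.absoluteGaloisGroup ℚ) (P : geomTorsion W₁ (p : ℤ)), e (σ • P) = σ • e P) :
    ¬ BigIm W₁ p :=
  not_bigIm_of_irr_of_not_surj W₁ p (hasIrreducibleModPGaloisRep_of_torsionIso_symm e he hX.irr)
    fun hs₁ => hns (hasSurjectiveModNGaloisRep_of_torsionIso e he hs₁)

omit [W.IsElliptic] in
/-- … so BCS 2025 Thm. 1.1.2 (b) cannot even be INSTANTIATED at a partner of a non-surjective X11a
pair: its hypothesis tuple `3 < p ∧ GoodOrd W₁ p ∧ Irr W₁ p ∧ BigIm W₁ p` is refuted.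
[cite: BurungaleCastellaSkinner2025, Thm. 1.1.2 (b) (§1.1, p. 2)] -/
theorem _root_.Summit.BirchSwinnertonDyer.Rank1Residual.ClassX11a.not_bcsHypotheses_partner_of_not_surj
    (hX : ClassX11a W p) (hns : ¬ Surj W p)
    (e : geomTorsion W₁ (p : ℤ) ≃+ geomTorsion W (p : ℤ))
    (he : ∀ (σ : Field.absoluteGaloisGroup ℚ) (P : geomTorsion W₁ (p : ℤ)), e (σ • P) = σ • e P) :
    ¬ (3 < p ∧ GoodOrd W₁ p ∧ Irr W₁ p ∧ BigIm W₁ p) :=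
  fun h => hX.not_bigIm_partner_of_not_surj hns e he h.2.2.2

end PartnerHypotheses

/-! ### §2 The tool: Mazur's statement with `μ = 0` at the multiplicative prime from a BCS partner -/

section Tool

variable (W W₁ : WeierstrassCurve ℚ) [W.IsElliptic] [W.IsGloballyMinimal] [W₁.IsElliptic]
  [W₁.IsGloballyMinimal] (p : ℕ) [Fact p.Prime]

/-- **Mazur's main conjecture at a MULTIPLICATIVE prime `p ≥ 5`, integrally and with `μ = 0`, from a
GOOD-ORDINARY congruent partner with big image and one unit coefficient** (`E = W` globally minimal,
multiplicative at `p`, `E[p]` irreducible, `ρ̄_{E,p}` onto; partner `E₁ = W₁` globally minimal, good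
ordinary at `p`, `E₁[p] ≃ E[p]` `Γ_ℚ`-equivariantly; certificate `hcert₁`: for the newform `f₁` of
`E₁` and every `ϖ₁` with `ϖ₁ · Ω_{E₁} = Ω⁺_{f₁}`, some coefficient of `ϖ₁ · L_p(f₁, α₁)` is a `p`-adic
unit). Chain: BCS 2025 Thm. 1.1.2 (b) (`hBCS`) + `hcert₁` ⇒ `GoodOrdinaryCharIdealMuZero W₁ p`
(`X11b.ClassClosure.goodOrdinaryCharIdealMuZero_of_thm112b`, with (irr_ℚ), (im) for `E₁` transported
from `E`); EPW Cor. 5.1.4 + Thm. 5.1.3 (`hEPW`) ⇒ `MultiplicativeCharIdealMuZero W p`. Class-free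
(serves X11a, `r = 0`, and X11b, `r = 1`, alike); the partner's rank / `L`-value / BSD status play no
role. CONDITIONAL on the two named facts and the per-pair data; nothing booked.
[cite: BurungaleCastellaSkinner2025, Thm. 1.1.2 (b) (§1.1, p. 2 of arXiv:2405.00270v2)]
[cite: EmertonPollackWeston2006, Cor. 5.1.4 and Thm. 5.1.3 (arXiv:math/0404484 p. 30)] -/
theorem multCharIdealMuZero_of_bcsPartner
    (hBCS : thm112b_charIdeal_eq_padicLFunction_integral) (hEPW : cor514_transfer_of_goodOrdinary)
    (h5 : 5 ≤ p) (hmult : W.HasMultiplicativeReductionAtPrime p)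
    (hirr : W.HasIrreducibleModPGaloisRep p) (hsurj : W.HasSurjectiveModNGaloisRep p)
    (hgood₁ : W₁.HasGoodReductionAtPrime p) (hord₁ : ¬ (p : ℤ) ∣ W₁.frobeniusTrace p)
    (hiso : ∃ e : geomTorsion W₁ (p : ℤ) ≃+ geomTorsion W (p : ℤ),
      ∀ (σ : Field.absoluteGaloisGroup ℚ) (P : geomTorsion W₁ (p : ℤ)), e (σ • P) = σ • e P)
    (hcert₁ : ∀ [NeZero (W₁.conductorNorm ℤ)] (f₁ : CuspForm (Gamma0 (W₁.conductorNorm ℤ)) 2),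
        IsNewformOf W₁ f₁ → ∀ (ϖ : ℚ), (ϖ : ℝ) * W₁.realPeriodRat = plusPeriod f₁ →
      ∃ n : ℕ, ‖PowerSeries.coeff n
        (PowerSeries.C (ϖ : ℚ_[p]) * padicLFunction f₁ (unitRoot W₁ p : ℚ_[p]))‖ = 1) :
    MultiplicativeCharIdealMuZero W p := by
  obtain ⟨e, he⟩ := hiso
  have hirr₁ : W₁.HasIrreducibleModPGaloisRep p :=
    hasIrreducibleModPGaloisRep_of_torsionIso_symm e he hirr
  have hsurj₁ : Surj W₁ p :=
    hasSurjectiveModNGaloisRep_of_torsionIso e.symm (torsionIso_symm_smul e he) hsurj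
  have him₁ : BigIm W₁ p := X9.bigIm_of_surj W₁ p h5 hsurj₁
  have h₁ : GoodOrdinaryCharIdealMuZero W₁ p :=
    X11b.ClassClosure.goodOrdinaryCharIdealMuZero_of_thm112b hBCS W₁ p (by omega) ⟨hgood₁, hord₁⟩
      hirr₁ him₁ hcert₁
  exact hEPW W₁ W p h5 hgood₁ hord₁ hmult ⟨e, he⟩ hirr₁ h₁

end Tool

/-! ### §3 On the leaf: Mazur's main conjecture, `BSD(E,p)`, and the crux's lower half, per pair -/

section ClassForms

variable {W : WeierstrassCurve ℚ} [W.IsElliptic] [W.IsGloballyMinimal] {p : ℕ} [Fact p.Prime]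

/-- **X11a, surjective image, BCS partner ⇒ Mazur's main conjecture at the pair** (the leaf's typed
input `X2.MazurMainConjectureAt W p`; `μ = 0` dropped by `mazurMainConjectureAt_of_multCharIdealMuZero`).
Class side: `5 ≤ p` from `p ≠ 3`, multiplicative, irreducible. [cite: BurungaleCastellaSkinner2025, Thm. 1.1.2 (b) (§1.1, p. 2)]
[cite: EmertonPollackWeston2006, Cor. 5.1.4 and Thm. 5.1.3 (arXiv:math/0404484 p. 30)] -/
theorem _root_.Summit.BirchSwinnertonDyer.Rank1Residual.ClassX11a.mazurMainConjectureAt_of_bcsPartner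
    (hBCS : thm112b_charIdeal_eq_padicLFunction_integral) (hEPW : cor514_transfer_of_goodOrdinary)
    (hX : ClassX11a W p) (h3 : p ≠ 3) (hsurj : Surj W p)
    (W₁ : WeierstrassCurve ℚ) [W₁.IsElliptic] [W₁.IsGloballyMinimal]
    (hgood₁ : W₁.HasGoodReductionAtPrime p) (hord₁ : ¬ (p : ℤ) ∣ W₁.frobeniusTrace p)
    (hiso : ∃ e : geomTorsion W₁ (p : ℤ) ≃+ geomTorsion W (p : ℤ),
      ∀ (σ : Field.absoluteGaloisGroup ℚ) (P : geomTorsion W₁ (p : ℤ)), e (σ • P) = σ • e P)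
    (hcert₁ : ∀ [NeZero (W₁.conductorNorm ℤ)] (f₁ : CuspForm (Gamma0 (W₁.conductorNorm ℤ)) 2),
        IsNewformOf W₁ f₁ → ∀ (ϖ : ℚ), (ϖ : ℝ) * W₁.realPeriodRat = plusPeriod f₁ →
      ∃ n : ℕ, ‖PowerSeries.coeff n
        (PowerSeries.C (ϖ : ℚ_[p]) * padicLFunction f₁ (unitRoot W₁ p : ℚ_[p]))‖ = 1) :
    X2.MazurMainConjectureAt W p :=
  mazurMainConjectureAt_of_multCharIdealMuZero
    (multCharIdealMuZero_of_bcsPartner W W₁ p hBCS hEPW (hX.five_le_of_ne_three h3) hX.mult hX.irr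
      hsurj hgood₁ hord₁ hiso hcert₁)

/-- **X11a, surjective image: `BSD(E,p)` from a BCS partner and one unit coefficient — PUBLISHED
facts only** (Burungale–Castella–Skinner 2025 Thm. 1.1.2 (b) `hBCS`, Emerton–Pollack–Weston 2006
Cor. 5.1.4 `hEPW`, Stein–Wuthrich 2013 Thm. 6.1 split / non-split `hJs`/`hJn`, Greenberg–Stevens
`hGS`, Gross–Zagier–Kolyvagin `hGZK`, modularity `hmod`/`hpar`; NO (ram), NO `μ`-hypothesis on `E`,
NO height-existence fact — glue `bsdp_of_mazurMainConjectureAt_heightFree`). Per pair: the image bit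
`Surj W p`, the partner `W₁` (good ordinary at `p`) with `W₁[p] ≃ W[p]`, and the certificate
`hcert₁`. The μ-TRANSPORT line of the route's crux `X11aLowerHalf`, BY NAME on the leaf; E1-pair
currency, never the class. [cite: BurungaleCastellaSkinner2025, Thm. 1.1.2 (b) (§1.1, p. 2)]
[cite: EmertonPollackWeston2006, Cor. 5.1.4 and Thm. 5.1.3 (arXiv:math/0404484 p. 30)]
[cite: SteinWuthrich2013, Thm. 6.1 (p. 20)] [cite: Miller2011LMS, Def. 1.1 and §1] -/
theorem bsdp_of_bcsPartner
    (hBCS : thm112b_charIdeal_eq_padicLFunction_integral) (hEPW : cor514_transfer_of_goodOrdinary)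
    (hJs : thm61_splitMultiplicative) (hJn : thm61_nonsplitMultiplicative)
    (hGZK : rank_eq_analyticRank_of_analyticRank_le_one) (hmod : hasEntireLFunction_rat)
    (hpar : nonempty_modularParametrizationData)
    (hGS : greenberg_stevens (W := W) (p := p))
    (hX : ClassX11a W p) (h3 : p ≠ 3) (hsurj : Surj W p)
    (W₁ : WeierstrassCurve ℚ) [W₁.IsElliptic] [W₁.IsGloballyMinimal]
    (hgood₁ : W₁.HasGoodReductionAtPrime p) (hord₁ : ¬ (p : ℤ) ∣ W₁.frobeniusTrace p)
    (hiso : ∃ e : geomTorsion W₁ (p : ℤ) ≃+ geomTorsion W (p : ℤ),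
      ∀ (σ : Field.absoluteGaloisGroup ℚ) (P : geomTorsion W₁ (p : ℤ)), e (σ • P) = σ • e P)
    (hcert₁ : ∀ [NeZero (W₁.conductorNorm ℤ)] (f₁ : CuspForm (Gamma0 (W₁.conductorNorm ℤ)) 2),
        IsNewformOf W₁ f₁ → ∀ (ϖ : ℚ), (ϖ : ℝ) * W₁.realPeriodRat = plusPeriod f₁ →
      ∃ n : ℕ, ‖PowerSeries.coeff n
        (PowerSeries.C (ϖ : ℚ_[p]) * padicLFunction f₁ (unitRoot W₁ p : ℚ_[p]))‖ = 1) :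
    BSDp W p :=
  bsdp_of_mazurMainConjectureAt_heightFree hJs hJn hGZK hmod hpar hGS hX
    (hX.mazurMainConjectureAt_of_bcsPartner hBCS hEPW h3 hsurj W₁ hgood₁ hord₁ hiso hcert₁)

/-- **The same with modularity counted ONCE** (`hNf : exists_isNewformOf`; `hasEntireLFunction_rat`
and the parametrisation datum are its tree consequences, as in `X11a/CMPartner.lean`).
[cite: BurungaleCastellaSkinner2025, Thm. 1.1.2 (b) (§1.1, p. 2)]
[cite: EmertonPollackWeston2006, Cor. 5.1.4 and Thm. 5.1.3 (arXiv:math/0404484 p. 30)]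
[cite: BreuilConradDiamondTaylor2001, Thm. A] -/
theorem bsdp_of_bcsPartner' (hNf : exists_isNewformOf)
    (hBCS : thm112b_charIdeal_eq_padicLFunction_integral) (hEPW : cor514_transfer_of_goodOrdinary)
    (hJs : thm61_splitMultiplicative) (hJn : thm61_nonsplitMultiplicative)
    (hGZK : rank_eq_analyticRank_of_analyticRank_le_one)
    (hGS : greenberg_stevens (W := W) (p := p))
    (hX : ClassX11a W p) (h3 : p ≠ 3) (hsurj : Surj W p)
    (W₁ : WeierstrassCurve ℚ) [W₁.IsElliptic] [W₁.IsGloballyMinimal]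
    (hgood₁ : W₁.HasGoodReductionAtPrime p) (hord₁ : ¬ (p : ℤ) ∣ W₁.frobeniusTrace p)
    (hiso : ∃ e : geomTorsion W₁ (p : ℤ) ≃+ geomTorsion W (p : ℤ),
      ∀ (σ : Field.absoluteGaloisGroup ℚ) (P : geomTorsion W₁ (p : ℤ)), e (σ • P) = σ • e P)
    (hcert₁ : ∀ [NeZero (W₁.conductorNorm ℤ)] (f₁ : CuspForm (Gamma0 (W₁.conductorNorm ℤ)) 2),
        IsNewformOf W₁ f₁ → ∀ (ϖ : ℚ), (ϖ : ℝ) * W₁.realPeriodRat = plusPeriod f₁ →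
      ∃ n : ℕ, ‖PowerSeries.coeff n
        (PowerSeries.C (ϖ : ℚ_[p]) * padicLFunction f₁ (unitRoot W₁ p : ℚ_[p]))‖ = 1) :
    BSDp W p :=
  bsdp_of_bcsPartner hBCS hEPW hJs hJn hGZK (hasEntireLFunction_rat_of_exists_isNewformOf hNf)
    (nonempty_modularParametrizationData_of_exists_isNewformOf hNf
      IsNewformOf.exists_maninConstant_ne_zero_holds)
    hGS hX h3 hsurj W₁ hgood₁ hord₁ hiso hcert₁

/-- **The crux's body at the pair**: on X11a with surjective image, a BCS partner + one unit
coefficient give the LOWER half `Typed.MissingLowerBoundAt W p` (`ord_p #Ш_an ≤ ord_p #Ш` — verbatim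
the body of item stmt-BirchSwinnertonDyer-19064 `X11aLowerHalf` at `(W, p)`), and the upper half with
it (`BSDp` ⇒ both halves, `Ш` finite by `hGZK`). [cite: Miller2011LMS, Def. 1.1 and §1]
[cite: BurungaleCastellaSkinner2025, Thm. 1.1.2 (b) (§1.1, p. 2)]
[cite: EmertonPollackWeston2006, Cor. 5.1.4 and Thm. 5.1.3 (arXiv:math/0404484 p. 30)] -/
theorem _root_.Summit.BirchSwinnertonDyer.Rank1Residual.ClassX11a.halves_of_bcsPartner
    (hNf : exists_isNewformOf)
    (hBCS : thm112b_charIdeal_eq_padicLFunction_integral) (hEPW : cor514_transfer_of_goodOrdinary)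
    (hJs : thm61_splitMultiplicative) (hJn : thm61_nonsplitMultiplicative)
    (hGZK : rank_eq_analyticRank_of_analyticRank_le_one)
    (hGS : greenberg_stevens (W := W) (p := p))
    (hX : ClassX11a W p) (h3 : p ≠ 3) (hsurj : Surj W p)
    (W₁ : WeierstrassCurve ℚ) [W₁.IsElliptic] [W₁.IsGloballyMinimal]
    (hgood₁ : W₁.HasGoodReductionAtPrime p) (hord₁ : ¬ (p : ℤ) ∣ W₁.frobeniusTrace p)
    (hiso : ∃ e : geomTorsion W₁ (p : ℤ) ≃+ geomTorsion W (p : ℤ),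
      ∀ (σ : Field.absoluteGaloisGroup ℚ) (P : geomTorsion W₁ (p : ℤ)), e (σ • P) = σ • e P)
    (hcert₁ : ∀ [NeZero (W₁.conductorNorm ℤ)] (f₁ : CuspForm (Gamma0 (W₁.conductorNorm ℤ)) 2),
        IsNewformOf W₁ f₁ → ∀ (ϖ : ℚ), (ϖ : ℝ) * W₁.realPeriodRat = plusPeriod f₁ →
      ∃ n : ℕ, ‖PowerSeries.coeff n
        (PowerSeries.C (ϖ : ℚ_[p]) * padicLFunction f₁ (unitRoot W₁ p : ℚ_[p]))‖ = 1) :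
    MissingLowerBoundAt W p ∧ MissingUpperBoundAt W p := by
  haveI : Finite W.sha := hX.finite_sha hGZK
  exact lower_and_upper_of_missingPPartAt W p (missingPPartAt_of_bsdp W p
    (bsdp_of_bcsPartner' hNf hBCS hEPW hJs hJn hGZK hGS hX h3 hsurj W₁ hgood₁ hord₁ hiso hcert₁))

/-- **The μ-transport line into crux 19064, BY NAME**: `Typed.MissingLowerBoundAt W p` on the
surjective X11a leaf at `p ≠ 3` from a BCS partner and one unit coefficient.
[cite: Miller2011LMS, Def. 1.1] [cite: BurungaleCastellaSkinner2025, Thm. 1.1.2 (b) (§1.1, p. 2)]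
[cite: EmertonPollackWeston2006, Cor. 5.1.4 and Thm. 5.1.3 (arXiv:math/0404484 p. 30)] -/
theorem _root_.Summit.BirchSwinnertonDyer.Rank1Residual.ClassX11a.missingLowerBoundAt_of_bcsPartner
    (hNf : exists_isNewformOf)
    (hBCS : thm112b_charIdeal_eq_padicLFunction_integral) (hEPW : cor514_transfer_of_goodOrdinary)
    (hJs : thm61_splitMultiplicative) (hJn : thm61_nonsplitMultiplicative)
    (hGZK : rank_eq_analyticRank_of_analyticRank_le_one)
    (hGS : greenberg_stevens (W := W) (p := p))
    (hX : ClassX11a W p) (h3 : p ≠ 3) (hsurj : Surj W p)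
    (W₁ : WeierstrassCurve ℚ) [W₁.IsElliptic] [W₁.IsGloballyMinimal]
    (hgood₁ : W₁.HasGoodReductionAtPrime p) (hord₁ : ¬ (p : ℤ) ∣ W₁.frobeniusTrace p)
    (hiso : ∃ e : geomTorsion W₁ (p : ℤ) ≃+ geomTorsion W (p : ℤ),
      ∀ (σ : Field.absoluteGaloisGroup ℚ) (P : geomTorsion W₁ (p : ℤ)), e (σ • P) = σ • e P)
    (hcert₁ : ∀ [NeZero (W₁.conductorNorm ℤ)] (f₁ : CuspForm (Gamma0 (W₁.conductorNorm ℤ)) 2),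
        IsNewformOf W₁ f₁ → ∀ (ϖ : ℚ), (ϖ : ℝ) * W₁.realPeriodRat = plusPeriod f₁ →
      ∃ n : ℕ, ‖PowerSeries.coeff n
        (PowerSeries.C (ϖ : ℚ_[p]) * padicLFunction f₁ (unitRoot W₁ p : ℚ_[p]))‖ = 1) :
    MissingLowerBoundAt W p :=
  (hX.halves_of_bcsPartner hNf hBCS hEPW hJs hJn hGZK hGS h3 hsurj W₁ hgood₁ hord₁ hiso hcert₁).1

end ClassForms

end Summit.BirchSwinnertonDyer.Rank1Residual.X11a

end
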